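import Mathlib
import HarnessLib
import HarnessLib.Audit
import Summits.FinalStateConjecture.Statement
import Literature.Geometry.Lorentzian.RecedingKerrInitialLayerNorm
import HarnessLib.Audit.Status.Attr

/-!
Route: DerivativeThrift

DORMANT since 2026-08-25T13:14:40Z (reconciler: no traction for 7.7 d (last activity item-evidence-added at 2026-08-17T19:15:43Z); parked, not closed — `ledger route dormant route-FinalStateConjecture-DerivativeThrift --off` to reactiva) — unstaffed, not closed; items shared with open routes are served there. `ledger route dormant <id> --off` reactivates.

# Route DerivativeThrift — decide the conjecture at its own regularity — derivative-thrifty Kerr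
stability is where the siblings' transfer breaks

It suffices to show X = ThriftyKerrStability ∧ ThriftyClusterSettling ∧ ThriftyHandoff (lens
TRANSFER from the solved siblings CK93/Bieri10,
DHRT21, KS23+GKS22, Hintz 2026; no card realised). Port the sibling proof chain (1 hypothesis:
ε-closeness to the family at HIGH Sobolev order
d ≫ loss; 2 Cauchy stability; 3 linear decay with fixed derivative loss; 4 bootstrap/Nash–Moser; 5
modulation; 6 u_f → ∞) to a late
hypersurface of a large-data development: steps 2–6 transfer verbatim once step 1 holds, and step 1
breaks in transit in three separable
ways — (a) largeness (the owned "capture" problem), (b) the hand-over HYPERSURFACE/TOPOLOGY (an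
asymptotically flat leaf in H^s_δ pins the
ADM mass for δ ≥ 1 and carries the whole outgoing radiation shell with weighted C²-norm ~ T^(δ+2) →
∞ for δ > −2, so it can only be fed by
non-radiating data), and (c) the ORDER d: no large-data a-priori structure bounds more than
energy-level + O(1) derivatives at late
times, so smallness at Hintz's "large d" / KS's k_large is undeliverable by any honest front end.
THE CRUX is (c): ThriftyKerrStability =
asymptotic stability of every sub-extremal Kerr from ONE-TIME smallness of the k = 2 layer norm 𝔑
(near C² sup + far r^p/transversal fluxes
of ψ_m = r·D^m h, m ≤ 2; (p, δ) = (1/2, 1/2)) on a hyperboloidal layer embedded in the development,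
with NO side condition on higher
derivatives — the Statement's own C² order at the hand-over and the Statement's own C² order in the
conclusion (rev 1, after
route-review R2: the conclusion is NEAR-ZONE C² convergence to Kerr (M′, a′) inside J⁺(layer) out to
growing radii R(σ) → ∞, in a
future-oriented Kerr–Schild chart — not convergence on asymptotically flat slabs, which reach i⁰ and
never lie in J⁺ of a hyperboloidal
layer; scales ℓ ≥ 4M₀ so that the C²-controlled near layer is non-empty and contains the whole
trapping region). ThriftyClusterSettling:
granted that, receding thrifty N-hole layers (N ≥ 0, separating centres, orthochronous boosts with
distinct velocities) settle in the
re-typed sense (sub-extremal holes, O = exteriorOf, HasExhaustiveCharts with honest radii,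
IsFutureOriented charts; re-type T2, p126844).
ThriftyHandoff (the ONE generic statement, now TAME-Christodoulou-generic: witness families on one
fixed end, weighted-C²-continuous and
immersed at the base datum, re-type T2): an MGHD exists and every MGHD has complete 𝓘⁺, CAPTURES
RAYS — for every honest typed
decomposition (O, d) of it, every future-complete normalised null ray from Σ stays in closure O (the
Statement's intrinsic clause C,
an interior-termination statement placed on the large-data side where it belongs) — and admits, for
every scale ℓ and accuracy ε,
arbitrarily late ε-thrifty separating N-hole layers. Support: ThriftyMinkowskiStability (N = 0,
Bieri's regularity in layer form).
Lean: `ThriftyKerrStability ∧ ThriftyClusterSettling ∧ ThriftyHandoff`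

## Assembly
Pure logic, sorry-free in Sketch.lean / glue.lean (`closes`, lean check rc 0; re-elaborated rev 1
against the re-typed Statement): TAME
Christodoulou codimension is antitone in the exceptional set (`mono` inside `closes`), so it
suffices that the generic property Q of
ThriftyHandoff implies the Statement's property P pointwise on admissible data; Q copies MGHD
existence and completeness of 𝓘⁺,
ThriftyClusterSettling applied to ThriftyKerrStability turns Q's hand-over into the honest,
future-oriented, exhaustive sub-extremal C²
decomposition (O, d) for every MGHD, and Q's ray-capture clause instantiated at that (O, d) gives
RaysStayInClosure. The deciding theorem is `closes : ThriftyKerrStability → ThriftyClusterSettling →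
ThriftyHandoff → FinalStateConjecture`; the Assembly item below is its uncurried frame (bookkeeping;
`closes` decides, D-0027).

Rationale: WHY THIS LINE. Mechanism = regularity-matched hand-over: the large-data front end is asked only for
what monotone budgets and compactness could
conceivably deliver (and what the Statement's C² conclusion itself nearly asserts on near zones),
and the small-data endgame is made to pay
the derivatives — "derivative thrift": run Kerr stability at the budget of the linear decay black
box (boundedness + ILED losing ≤ 1+ε at
trapping + r^p, DafermosRodnianski2010ICMP, Moschidis2016, DafermosEtAl2022, MaSzeftel2024,
Hintz2026Waves2) with first-order Bel–Robinson
curvature energies (div-free in vacuum; ChristodoulouKlainerman1993, Bieri2010JDG = Minkowski at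
curvature + 1 derivative) and the
low-regularity bilinear/Strichartz technology built for exactly this on black holes
(MarzuolaEtAl2008, Tohaneanu2009, LindbladEtAl2013;
parametrix/null structure at L² curvature, KlainermanRodnianskiSzeftel2015) in place of
Klainerman–Sobolev commutation, GCM sphere
construction at top order and Nash–Moser's 3×loss (KlainermanSzeftel2023, arXiv:2205.14808,
DafermosHolzegelRodnianskiTaylor2021, Hintz2026).
Imported area: low-regularity hyperbolic PDE (dispersive/Strichartz, L²-curvature methods) pointed
at the Kerr endgame — absent from all 53
theses of this summit (grep: no route uses Strichartz/bilinear/L²-curvature as a lever;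
RenormalisedDrift "deliberately leaves the
regularity gap inside DriftCapture"; KerrnessPropagates lets the endgame choose k;
PhaseMixingCapture imports Hintz's existential (s, δ) on
an AF leaf, which by Literature.Geometry.Lorentzian.ADMEnergyPinning is feedable only by
same-ADM-mass, i.e. non-radiating, data). Hand-over
currency = the tree's hyperboloidal-layer norm (KlainermanSzeftel2023 §3.6 initial layer; definition
request of EIHFluxBalance, used there
informally with k ≥ 6 and EIH modulation); the weights (p, δ) = (1/2, 1/2) are forced by a defect
recorded under Numbers (flat frame + flat
hyperboloids in Kerr–Schild coordinates misread outgoing radiation at order M/r and reach i⁰, so the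
far flux of every late layer of a
radiating development is +∞ for p ≥ 1). Negatives index: the one refuted statement (uniform
photon-sphere channels) is unrelated.

RANKED CRUXES. #2 ThriftyKerrStability (crux) — (transfer crux; sibling step 1 re-typed at the order
large data can pay; conclusion re-typed rev 1 after route-review R2) for every sub-extremal (M₀,
a₀), every layer scale ℓ ≥ 4M₀ and tolerance η > 0 there is ε > 0 such that: in every MGHD of
admissible data, every smooth open embedding Φ of the single-Kerr hyperboloidal layer
RecedingKerr.layer (N = 1, Λ = 1, centre 0, lab time τ, scale ℓ) with image in J⁺(ιX), achronal
leaves and k = 2 layer norm 𝔑_(2,1/2,1/2)(Φ) ≤ ε is followed by a Kerr NEAR ZONE: sub-extremal (M′,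
a′) with |M′ − M₀| + |a′ − a₀| ≤ η, a late Kerr–Schild chart Ψ of {r > r₊(M′,a′)} into J⁺(range Φ)
(IsLateChart) and radii R(σ) → ∞ with the C² deviation of Ψ^*g from g_(M′,a′) on the truncated slabs
{t* = σ, r ≤ R(σ)} → 0 and the push-forward of the Kerr time vector eventually future-directed
there. Rev 0 asked for ConvergesToKerr on a region inside J⁺(layer), i.e. for asymptotically flat
Kerr–Schild slabs out to i⁰ inside the future of a hyperboloidal layer — unsatisfiable (t* − r is
non-decreasing along future causal curves in Schwarzschild; R2); and scales ℓ ≤ M₀ made the near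
layer empty (R2, W2b.lean) — hence ℓ ≥ 4M₀ (near C² control then covers horizon, ergoregion and
photon region; far fluxes start in the untrapped zone). No b-conormality, no smallness above order 2
(near sup) / 3 (far flux); hypotheses are met with 𝔑 = 0 in developments with an eventually
Schwarzschild exterior (KehleUnger2024EventHorizonGluing, modulo regularity class), so the item is
not vacuous. [difficulty: open-problem] (why it might fail: every spin-2 decay mechanism on Kerr in
print costs ≥ 2 extra derivatives (DHR transformation P = ∇∇α, Teukolsky–Starobinsky, Carter
commutation); below Bieri's curvature+1 level nothing global is known even for Minkowski; p = 1/2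
admits slow incoming tails (t^(−1/2)-level linear decay); the far sheet is controlled at H³-flux
level only.) [Hintz2026, KlainermanSzeftel2023, DafermosHolzegelRodnianskiTaylor2021,
arXiv:2104.08222, Bieri2010JDG, DafermosRodnianski2010ICMP, MarzuolaEtAl2008, Tohaneanu2009,
LindbladEtAl2013, KlainermanRodnianskiSzeftel2015, DafermosEtAl2022, MaSzeftel2024, Hintz2026Waves2,
KehleUnger2024EventHorizonGluing]
#3 ThriftyClusterSettling (crux) — (sibling steps 2–6 plus the N-body bookkeeping the siblings never
needed) granted ThriftyKerrStability: for every admissible datum and every MGHD with complete 𝓘⁺, IF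
there are N, sub-extremal (Mᵢ, aᵢ) and orthochronous Lorentz motions Λᵢ with pairwise distinct
3-velocities such that for every ℓ > 0, ε > 0 and τ₁ there is a lab time τ ≥ τ₁, centres ξᵢ
(pairwise ≥ ε⁻¹ apart and non-approaching: ⟪ξᵢ − ξⱼ, vᵢ − vⱼ⟫ ≥ 0) and a smooth open embedding Φ of
the N-hole layer RecedingKerr.layer M a Λ ξ τ ℓ with image in J⁺(ιX), achronal leaves and
𝔑_(2,1/2,1/2)(Φ) ≤ ε, THEN the exterior settles in the RE-TYPED sense (T2, p126844): ∃ O d,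
FinalStateDecomposition … O 2 with sub-extremal holes, O = exteriorOf d.charted, HasExhaustiveCharts
d (honest radii Rᵢ ≥ max(r₊, 0) + 1, Rᵢ → ∞) and IsFutureOriented d (orthochronous motions,
eventually future-directed push-forwards) — N = 0 = dispersal included; the final number of holes is
d.N, not N; the i⁰ corner of the flat chart is fed by the datum's asymptotic flatness (exterior
stability, KlainermanNicolo2003), not by the layers; the ray clause C is NOT this item's (it is
carried by ThriftyHandoff and instantiated at (O, d) in `closes`). [deps: ThriftyKerrStability]
[difficulty: open-problem] (why it might fail: receding decoupling at thrift regularity needs ILED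
uniform on a MOVING N-centre background (no printed theory beyond one stationary trapped set);
ThriftyKerrStability is a black box for N = 1 only; the N = 0 leg needs layer-form Minkowski
stability at p = 1/2; exhaustive-chart bookkeeping must bridge the near-zone/radiation-zone/i⁰ necks
and fix the orientation without rates.) [arXiv:1710.01722, KlainermanSzeftel2023, arXiv:2205.14808,
Hintz2026, DafermosRodnianski2010ICMP, Moschidis2016, Bieri2010JDG, KlainermanNicolo2003]
#4 ThriftyHandoff (crux) — (the large-data half, ONE TAME-Christodoulou-generic property, tame
codimension ≥ 1 in admissibleVacuumData X — witness families on one fixed asymptotically flat end,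
weighted-C²-continuous and immersed at the base datum, InitialDataSet.IsTameChristodoulouGeneric …
1, re-type T2): an MGHD exists, and every MGHD (i) has complete 𝓘⁺, (ii) CAPTURES RAYS: for every
honest typed decomposition (O, d) of it (sub-extremal holes, O = exteriorOf d.charted,
HasExhaustiveCharts d, IsFutureOriented d) every future-complete normalised null ray from Σ stays in
closure O (RaysStayInClosure; for honest d, closure O is the closure of the future domain of outer
communications whatever d is, so this is the Statement's intrinsic clause C — an
interior-termination statement: null rays from Σ entering a black hole are future-incomplete —
placed on the large-data side, not in the perturbative endgame), and (iii) admits a thrifty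
hand-over — N, sub-extremal labels, orthochronous boosts with distinct velocities, and for every ℓ,
ε, τ₁ a separating ε-thrifty N-hole layer after τ₁, verbatim the antecedent of
ThriftyClusterSettling. Contains weak cosmic censorship, finiteness of N, no eternal non-Kerr end
state, clause C, generic sub-extremality and generic HYPERBOLIC recession; asks for closeness only
at order 2 (near C² sup — implied by the Statement's own conclusion — plus far fluxes at p = 1/2,
under which old outgoing radiation is exponentially discounted on late layers). [difficulty:
open-problem] (why it might fail: it is WCC plus capture plus C: naked singularities or a non-Kerr
ω-limit from an open set of data refute it; parabolic (t^(2/3)) recession or equal terminal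
velocities may be generic, not codimension 1; clause C is refuted for a topology X on which a
curve-stable expanding vacuum pocket sits behind a horizon (X = ℝ³ # T³ or ℝ³ # H³/Γ with
Kasner/Milne-type data glued in through a neck, IsenbergMazzeoPollack2002, AnderssonMoncrief2003:
complete rays off closure O); even order-2 smallness needs a regularity gain from energy-level
budgets nobody has.) [Christodoulou1999, arXiv:1710.01722, DafermosRodnianski2008,
DafermosRodnianski2013, KlainermanSzeftel2023, Bartnik1986, IsenbergMazzeoPollack2002,
AnderssonMoncrief2003]
#9 ThriftyMinkowskiStability (support) — the N = 0 analogue of ThriftyKerrStability (conclusion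
re-typed rev 1, same R2 defect): for every ℓ > 0 there is ε > 0 such that every smooth open
embedding Φ of the empty-configuration (Minkowski) layer into an MGHD of admissible data, image in
J⁺(ιX), achronal leaves, 𝔑_(2,1/2,1/2) ≤ ε, is followed by a flat near zone: a late chart Ψ of
Minkowski space into J⁺(range Φ) (IsLateChart) and radii R(σ) → ∞ with the C² deviation of Ψ^*g from
η on the balls {x⁰ = σ, |x̲| ≤ R(σ)} → 0 and ∂₀ eventually pushed forward future-directed (Bieri's
curvature+1-derivative theorem in hyperboloidal layer form, interior decay; the N = 0 leg of
ThriftyClusterSettling). [difficulty: XL] [Bieri2010JDG, ChristodoulouKlainerman1993,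
LindbladRodnianski2010Annals, Moschidis2016]

TWO-LAYER PLAN. ThriftyKerrStability ⇐ ThriftLinearFloor (boundedness + ILED + r^p for the
linearised gravity system on exact sub-extremal Kerr with data
measured ONLY in the k = 2 layer norm, loss ≤ 1 + ε) → ThriftClosure (tame closure of the nonlinear
terms at that regularity by
Strichartz/bilinear estimates, higher norms merely finite) → ThriftyKerrStability.
ThriftyClusterSettling ⇐ RecedingDecoupling (N-hole
layer stability from N single-hole statements + ThriftyMinkowskiStability when separations grow
linearly) → ExhaustiveBookkeeping →
ThriftyClusterSettling. ThriftyHandoff ⇐ CensoredThriftCapture (censored developments admit thrifty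
layers, pointwise) → generic legs
(censorship, hyperbolic recession, sub-extremality) glued by one transversality statement.
Restatement foreseen (1:1, `--restate`) of all
layer items in a Kerr-adapted layer norm (definition request below) with (p, δ) ∈ (1,2)×(0,1),
removing the slow-tail artefact of p = 1/2.

KILL CRITERIA. ThriftyKerrStability refuted by a genuine low-regularity instability ABOVE the local
well-posedness threshold (a family of perturbations
ε-small in 𝔑_(2,1/2,1/2) whose developments do not converge in C²) closes the route
`refuted:ThriftyKerrStability` — the thesis is then false
and every capture architecture must track high regularity through the large-data era; refuted only
through the p = 1/2 slow-tail
loophole (incoming tails with finite 𝔑 but infinite r^1-flux) ⇒ restate in the Kerr-adapted norm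
(misstated, not substantive).
ThriftyHandoff refuted through an open set of data with incomplete 𝓘⁺ kills every route of the
summit; refuted through generic parabolic
recession ⇒ pivot: drop the distinct-velocity clause and move Chazy–Marchal–Saari bookkeeping into
ThriftyClusterSettling; refuted through
clause C alone (a curve-stable expanding pocket behind a horizon on some topology X) refutes the
re-typed Statement itself for that X —
report `verdict: misstated` upward (the clause, not the line, is then wrong) rather than pivot.
ThriftyKerrStability / ThriftyMinkowskiStability refuted again through the SHAPE of the convergence
certificate (chart class, slab
geometry, orientation) rather than through an instability ⇒ misstated, restate 1:1; rev 1 already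
replaced the unsatisfiable
ConvergesToKerr-inside-J⁺(layer) conclusion of rev 0 by near-zone convergence (route-review R2,
2026-08-16).
Mooted (supersede) if a sibling route proves capture at Hintz's order s honestly (not by burial) —
then thrift was unnecessary.

NOT DECOMPOSED YET. The value of the thrift order (k = 2 chosen = the Statement's order; k = 3 =
Bieri's is the fallback), the linear floor at k = 2 for the
Teukolsky/linearised-gravity system (does spin-2 ILED exist without the two transformation
derivatives?), the N-hole moving-trapping ILED,
the exhaustive-chart neck lemma, every generic leg of ThriftyHandoff (censorship, census, no
breathers, third law, hyperbolic recession),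
and the regularity-gain mechanism (energy budgets → order 2) — all layer-2.

CHEAPEST FALSIFIER. (i) Literature: a global ill-posedness / instability result for vacuum Einstein
with data small at C²-sup + H³-flux level but large above
(none found: Ettinger–Lindblad's counterexample is at H², below local well-posedness; Lindblad's
quasilinear counterexamples likewise);
(ii) the N = 0 sanity check — Minkowski IS stable at curvature + 1 derivative (Bieri2010JDG Thm 1,
tree gr.S07 docstring) — passed;
(iii) a refuter's first computation: verify the Numbers claim that the tree's layer norm is +∞ for p
≥ 1 on Schwarzschild + one outgoing
linear wave (flat L misreads F(u)/r: L(rh) = −4M F′(u)/(r − 2M)); if that computation is WRONG,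
restate with p = 3/2 at once (cheaper items).

NUMBERS. Orders in print: CK93 curvature + 2 derivatives (s = 4), Bieri2010JDG curvature + 1 (s = 3,
weight δ = −1 in WeightedNorms convention),
KlainermanRodnianskiSzeftel2015 local existence at L² curvature (s = 2), classical local theory s >
5/2; KS23 s_max = k_large (hundreds),
Hintz2026 "H^d for some large d" + H_b^∞ (13.1a); linear losses: ILED 1 (+ε) at trapping (sharp by
SbierskiTrappingObstruction), r^p none,
red-shift none. This route: k = 2 (near C² sup; far first fluxes of r·D²h). Layer weights: outgoing
radiation h ≈ F(u)/r in Kerr–Schild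
coordinates has u = t* − r − 4M ln(r/2M − 1), flat outgoing derivative L u = −4M/(r − 2M), hence
r^p|L(r D^m h)|² ≈ 16M² r^(p−2)|F^(m+1)|²,
non-integrable along a leaf for p ≥ 1 whenever F′ ≠ 0 at the leaf's end, and flat hyperboloids end
at i⁰ (u → −∞), crossing radiation of
retarded time u at r ≈ e^((τ−u)/4M): contribution ∝ e^((p−1)(τ−u)/4M) — divergent for p > 1, an
O(E_rad) floor at p = 1, e^(−(τ−u)/8M)-small
at p = 1/2; transversal part ∝ e^(−δ(τ−u)/4M). Items at open: 5 (3 cruxes, 1 support, 1 assembly);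
rev 1 (2026-08-16, statement re-type T2 + route-review R2): all four statement items restated 1:1
under the same names, `closes` re-elaborated.

DEFINITION REQUESTS. (1) notion KerrAdaptedLayerNorm — the layer norm of
RecedingKerrInitialLayerNorm with (i) leaves asymptotic to the background's outgoing
null cones (height function with the tortoise logarithm, Moschidis2016 §1 / DafermosRodnianski2008
§5.3 Σ̃_τ) and (ii) the r^p and
transversal densities taken in the background Kerr–Schild null frame (Kerr.nullVector) instead of
the flat frame — topic
Literature/Geometry/Lorentzian; needed to restate all three layer items with (p, δ) ∈ (1,2)×(0,1).
(2) cite fact wanted: Bieri's theorem in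
hyperboloidal-layer form (Bieri2010JDG Thm 1 + domain of dependence), to discharge
ThriftyMinkowskiStability at p ∈ (1,2).

Novelty: Searches (2026-08-16): `lit search --hybrid "Kerr stability full subextremal range nonlinear"` (10:
Hintz 2606.28253 read pp 1–12,
2606.28008 pp 1–16, HHV 2506.21183, Ma–Szeftel, DHRT 2212.14093); `lit search --hybrid "low
regularity global stability Minkowski Einstein
vacuum rough data"` (12: CK93, LeFloch–Ma, Kroon — no low-regularity global theorem); `lit galaxy
search "Strichartz estimates on Kerr black
hole backgrounds" --star all` (4: Hintz polytrap, HV KdS, Andersson–Blue, Kofroth) and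
`"…Schwarzschild…" --star pdf` (8: + Looi 2208.05439,
Ma–Szeftel 2410.02341); `lit search --source zbmath "Strichartz estimates Kerr Tohaneanu"` (3:
Tohaneanu2009, LindbladEtAl2013,
Laul–Metcalfe–Tikare–Tohaneanu); arXiv/OpenAlex/S2 remote HTTP 429 this session; in-tree: grep of
all 53 theses for
"low regularity|L² curvature|Strichartz|bilinear|regularity gap" (hits only as caveats:
RenormalisedDrift L189, TangentConeAtIPlus L360,
CurvatureOrSymmetry L215), KerrStabilitySubextremalCauchy.lean (audit note "(ii) a bare finite-order
H^s_δ-ball is NOT covered"),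
ADMEnergyPinning.lean, Stability.lean gr.S04–S07, RecedingKerrInitialLayerNorm.lean; `ledger
negatives` (1, unrelated).
Nearest prior art found: Hintz2026 Thm 13.1 (smallness at one large order d + H_b^∞),
KlainermanSzeftel2023 §3.6 (initial-layer norm ℑ_k,
k large), Bieri2010JDG (Minkowski at curvature+1), MarzuolaEtAl2008/Tohaneanu2009/LindbladEtAl2013
(Strichartz and small-data SEMILINEAR
global existence on Schwarzschild/Kerr at  [refs: Tohaneanu2009, LindbladEtAl2013, Hintz2026, KlainermanSzeftel2023, MarzuolaEtAl2008]

Barriers (technique_class: kerr-stability, low-regularity, hyperboloidal-handover): - technique_class: kerr-stability, low-regularity, hyperboloidal-handover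
- Literature.Barriers.FinalStateConjecture.SlowlyRotatingKerrFrontier: met, not evaded —
ThriftyKerrStability quantifies over all |a₀| < M₀ like Hintz2026 (which discharges the frontier at
high regularity); the bet is orthogonal to the frontier (order, not spin).
- Literature.Barriers.FinalStateConjecture.SbierskiTrappingObstruction: honoured — the thrift budget
books exactly the one derivative (or ε) that trapping provably costs in ILED; the line fails if the
nonlinear closure needs more than that loss, which is its why-might-fail.
- Literature.Barriers.FinalStateConjecture.KerrSuperradiance: enters ThriftyKerrStability's linear
floor as in every Kerr route (no timelike Killing combination ⇒ boundedness entangled with ILED);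
mode stability (real axis) is imported input, not re-proved; bites hardest as |a₀| → M₀ where the
basin ε may degenerate (allowed: ε depends on (M₀, a₀)).
- Literature.Barriers.FinalStateConjecture.PriceLawTail: harmless — no decay RATE is asserted
anywhere (qualitative C² convergence; late layers exist at every accuracy); tails only limit the p
in the hand-over weights.
- Literature.Barriers.FinalStateConjecture.KehrbergerLogarithmicAsymptotics: harmless — no conformal
smoothness of 𝓘⁺ is used; the layer fluxes are r^p-weighted L², finite under logarithmic asymptotics
for p < 1 (indeed the log term is what forces p < 1, Numbers).
- Literature.Barriers.FinalStateConjecture.Aretakis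

History (route lifecycle, newest last):
- 2026-08-16T23:23:48Z · rev 1: restated ThriftyKerrStability (stmt-FinalStateConjecture-16092), ThriftyClusterSettling (stmt-FinalStateConjecture-16093), ThriftyHandoff (stmt-FinalStateConjecture-16094), ThriftyMinkowskiStability (stmt-FinalStateConjecture-16095) — route-repair (statement-revised p126844, re-type T2) + route-review R2 (refute (planner-rrepair-FinalStateConjecture-Derivativ-e2ae0c2e-0)
- 2026-08-25T13:14:40Z · DORMANT — reconciler: no traction for 7.7 d (last activity item-evidence-added at 2026-08-17T19:15:43Z); parked, not closed — `ledger route dormant route-FinalStateConjec (operator:999:1368052)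

sub-problem: FinalStateConjecture · status: dormant · opened planner-plan-lens-FinalStateConjecture-transfer-v2-0 2026-08-16T16:19:12Z · rev 2 · ledger route-FinalStateConjecture-DerivativeThrift
GENERATED by the gate from the ledger (D-0016/17). Provers cite these decls: `theorem foo : Summit.FinalStateConjecture.FinalStateConjecture.Theses.DerivativeThrift.<Decl> := …` in Summits/FinalStateConjecture/FinalStateConjecture/Theorems/<Name>.lean.
-/

namespace Summit.FinalStateConjecture.FinalStateConjecture.Theses.DerivativeThrift

open scoped BigOperators Topology Manifold Classical MeasureTheory ProbabilityTheory Matrix InnerProductSpace ComplexConjugate ContinuousMap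
open Filter Set Function TopologicalSpace MeasureTheory

attribute [summit_statement] _root_.FinalStateConjecture

-- earlier ThriftyKerrStability (stmt-FinalStateConjecture-16092, replaced 2026-08-16T23:23:48Z -> stmt-FinalStateConjecture-17610): retired by None — ∀ (M₀ a₀ : ℝ), Literature.Geometry.Lorentzian.Kerr.IsSubextremal M₀ a₀ → ∀ ℓ : ℝ, 0 < ℓ → ∀ η : ℝ, 0 < η → ∃ ε : ℝ, 0 < ε ∧ ∀ (X : Type) [TopologicalSpace X] [ChartedSpace Literature.Geometry.Lorentzian.E3 X] [IsManifold (𝓡 3) ((⊤ : ℕ∞) : WithTop ℕ∞) X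
/-- item stmt-FinalStateConjecture-17610 · crux · rank 2 · open · by planner
why it might fail: every spin-2 decay mechanism on Kerr in print costs ≥ 2 extra derivatives (DHR P = ∇∇α, Teukolsky–Starobinsky, Carter); below Bieri's curvature+1 level nothing global is known even for Minkowski; p = 1/2 admits slow incoming tails (t^(−1/2) linear decay); far sheet controlled at H³-flux level only.
sources: Hintz2026, KlainermanSzeftel2023, DafermosHolzegelRodnianskiTaylor2021, arXiv:2104.08222, Bieri2010JDG, DafermosRodnianski2010ICMP
[crux] (transfer crux; sibling step 1 re-typed at the order large data can pay; conclusion re-typed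
rev 1 after route-review R2) for every sub-extremal (M₀, a₀), every layer scale ℓ ≥ 4M₀ (so that the
C²-controlled near layer {|x̲| ≤ ℓ} is non-empty and contains horizon, ergoregion and photon region;
for ℓ ≤ M₀ it is empty, R2/W2b.lean) and every tolerance η > 0 there is ε > 0 such that: in every
MGHD of admissible data, every smooth open embedding Φ of the single-Kerr hyperboloidal layer
RecedingKerr.layer (N = 1, Λ = 1, centre 0, lab time τ, scale ℓ) with image in J⁺(ιX), achronal
leaves and k = 2 layer norm 𝔑_(2,1/2,1/2)(Φ) ≤ ε is followed by a KERR NEAR ZONE: there are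
sub-extremal (M′, a′) with |M′ − M₀| + |a′ − a₀| ≤ η, a late Kerr–Schild chart Ψ of the exterior {r
> r₊(M′,a′)} into J⁺(range Φ) (Spacetime.IsLateChart: smooth, an open embedding of {t* > τ′}, image
in J⁺(range Φ)) and radii R(σ) → ∞ such that the C² deviation of Ψ^*g from g_(M′,a′) on the
truncated slabs {t* = σ, r₊ < r ≤ R(σ)} tends to 0 as σ → ∞ (truncDeviationCk … 2), with the
push-forward of the Kerr time vector V_(M′,a′) = −g♯(dt*) eventually future-directed on every {t* =
σ, r ≤ ρ} (chart time = g-future) -/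
@[route_item "route-FinalStateConjecture-DerivativeThrift", crux]
def ThriftyKerrStability : Prop :=
  ∀ (M₀ a₀ : ℝ), Literature.Geometry.Lorentzian.Kerr.IsSubextremal M₀ a₀ → ∀ ℓ : ℝ, 4 * M₀ ≤ ℓ → ∀ η : ℝ, 0 < η → ∃ ε : ℝ, 0 < ε ∧ ∀ (X : Type) [TopologicalSpace X] [ChartedSpace Literature.Geometry.Lorentzian.E3 X] [IsManifold (𝓡 3) ((⊤ : ℕ∞) : WithTop ℕ∞) X] [T2Space X] [SecondCountableTopology X] [ConnectedSpace X] (D : Literature.Geometry.Lorentzian.InitialDataSet (𝓡 3) X), D ∈ Literature.Geometry.Lorentzian.admissibleVacuumData X → ∀ 𝒟 : Literature.Geometry.Lorentzian.VacuumCauchyDevelopment D, 𝒟.IsMaximal → ∀ (τ : ℝ) (Φ : Literature.Geometry.Lorentzian.RecedingKerr.layer (fun _ : Fin 1 ↦ M₀) (fun _ ↦ a₀) (fun _ ↦ 1) (fun _ ↦ 0) τ ℓ → 𝒟.carrier), ContMDiff 𝓘(ℝ, Literature.Geometry.Lorentzian.E4) (𝓡 4) ((⊤ : ℕ∞) : WithTop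 ℕ∞) Φ → Topology.IsOpenEmbedding Φ → Set.range Φ ⊆ 𝒟.metric.causalFuture 𝒟.timeOrientation (Set.range 𝒟.embed) → (∀ s₀ ∈ Set.Ioo 0 ℓ, 𝒟.metric.IsAchronal 𝒟.timeOrientation (Φ '' {x | Literature.Geometry.Lorentzian.RecedingKerr.layerTime τ ℓ x.1 = s₀})) → 𝒟.toSpacetime.recedingKerrInitialLayerNorm (fun _ : Fin 1 ↦ M₀) (fun _ ↦ a₀) (fun _ ↦ 1) (fun _ ↦ 0) τ ℓ 2 (1 / 2) (1 / 2) Φ ≤ ENNReal.ofReal ε → ∃ (M' a' τ' : ℝ) (Ψ : (Literature.Geometry.Lorentzian.Kerr.background M' a').domain → 𝒟.carrier) (R : ℝ → ℝ), Literature.Geometry.Lorentzian.Kerr.IsSubextremal M' a' ∧ |M' - M₀| + |a' - a₀| ≤ η ∧ 𝒟.toSpacetime.IsLateChart (Literature.Geometry.Lorentzian.Kerr.background M' a') (𝒟.metric.causalFuture 𝒟.timeOrientation (Set.range Φ)) τ' Ψ ∧ Filter.Tendsto R Filter.atTop Filter.atTop ∧ Filter.Tendsto (fun σ ↦ 𝒟.toSpacetime.truncDeviationCk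 (Literature.Geometry.Lorentzian.Kerr.background M' a') Ψ 2 (R σ) σ) Filter.atTop (nhds 0) ∧ ∀ ρ : ℝ, ∀ᶠ σ in Filter.atTop, ∀ x ∈ (Literature.Geometry.Lorentzian.Kerr.background M' a').truncTimeSlab ρ σ, 𝒟.timeOrientation.IsFutureDirected (mfderiv 𝓘(ℝ, Literature.Geometry.Lorentzian.E4) (𝓡 4) Ψ x (Literature.Geometry.Lorentzian.Kerr.timeVector M' a' (x : Literature.Geometry.Lorentzian.E4)))

-- earlier ThriftyClusterSettling (stmt-FinalStateConjecture-16093, replaced 2026-08-16T23:23:48Z -> stmt-FinalStateConjecture-17611): retired by None — ThriftyKerrStability → ∀ (X : Type) [TopologicalSpace X] [ChartedSpace Literature.Geometry.Lorentzian.E3 X] [IsManifold (𝓡 3) ((⊤ : ℕ∞) : WithTop ℕ∞) X] [T2Space X] [SecondCountableTopology X] [ConnectedSpace X] (D : Literature.Geometry.Lorentzian.In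
/-- item stmt-FinalStateConjecture-17611 · crux · rank 3 · open · by planner
why it might fail: receding decoupling at thrift regularity needs ILED uniform on a MOVING N-centre background (nothing printed beyond one stationary trapped set); TKS is a black box for N = 1 only; N = 0 leg = layer-form Minkowski stability at p = 1/2; exhaustion must bridge near/radiation/i⁰ zones without rates.
sources: arXiv:1710.01722, KlainermanSzeftel2023, arXiv:2205.14808, Hintz2026, DafermosRodnianski2010ICMP, Moschidis2016
[crux] (sibling steps 2–6 plus the N-body bookkeeping the siblings never needed) granted
ThriftyKerrStability: for every admissible datum and every MGHD with complete 𝓘⁺, IF there are N,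
sub-extremal (Mᵢ, aᵢ) and ORTHOCHRONOUS Lorentz motions Λᵢ with pairwise distinct 3-velocities such
that for every ℓ > 0, ε > 0 and τ₁ there is a lab time τ ≥ τ₁, centres ξᵢ (pairwise ≥ ε⁻¹ apart and
non-approaching: ⟪ξᵢ − ξⱼ, vᵢ − vⱼ⟫ ≥ 0) and a smooth open embedding Φ of the N-hole layer
RecedingKerr.layer M a Λ ξ τ ℓ with image in J⁺(ιX), achronal leaves and 𝔑_(2,1/2,1/2)(Φ) ≤ ε, THEN
the exterior settles in the RE-TYPED sense (T2, p126844): ∃ O d, FinalStateDecomposition … O 2 with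
sub-extremal holes, O = exteriorOf d.charted, HasExhaustiveCharts d (honest near-zone radii Rᵢ ≥
max(r₊, 0) + 1, Rᵢ → ∞, near-zone C² convergence out to Rᵢ, every point of O outside the certified
late region causally below the certified slab) and IsFutureOriented d (orthochronous motions;
push-forwards of the transported Kerr time vectors and of ∂₀ eventually future-directed on the
certified slabs). N = 0 = dispersal included; the final number of holes is d.N, not N; the i⁰ corner
of the flat chart is fed by the datu -/
@[route_item "route-FinalStateConjecture-DerivativeThrift", crux]
def ThriftyClusterSettling : Prop :=
  ThriftyKerrStability → ∀ (X : Type) [TopologicalSpace X] [ChartedSpace Literature.Geometry.Lorentzian.E3 X] [IsManifold (𝓡 3) ((⊤ : ℕ∞) : WithTop ℕ∞) X] [T2Space X] [SecondCountableTopology X] [ConnectedSpace X] (D : Literature.Geometry.Lorentzian.InitialDataSet (𝓡 3) X), D ∈ Literature.Geometry.Lorentzian.admissibleVacuumData X → ∀ 𝒟 : Literature.Geometry.Lorentzian.VacuumCauchyDevelopment D, 𝒟.IsMaximal → Summit.FinalStateConjecture.HasCompleteNullInfinity 𝒟.toCauchyDevelopment → (∃ (N : ℕ) (M a : Fin N →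 ℝ) (Λ : Fin N → ↥Literature.Geometry.Lorentzian.lorentzGroup), (∀ i, Literature.Geometry.Lorentzian.Kerr.IsSubextremal (M i) (a i)) ∧ (∀ i, Summit.FinalStateConjecture.IsOrthochronous (Λ i)) ∧ (∀ i j, i ≠ j → (((Λ i : Literature.Geometry.Lorentzian.E4 ≃L[ℝ] Literature.Geometry.Lorentzian.E4) (Literature.Geometry.Lorentzian.E4.basisVector 0)) 0)⁻¹ • Literature.Geometry.Lorentzian.E4.spatial ((Λ i : Literature.Geometry.Lorentzian.E4 ≃L[ℝ] Literature.Geometry.Lorentzian.E4) (Literature.Geometry.Lorentzian.E4.basisVector 0)) ≠ (((Λ j : Literature.Geometry.Lorentzian.E4 ≃L[ℝ] Literature.Geometry.Lorentzian.E4) (Literature.Geometry.Lorentzian.E4.basisVector 0)) 0)⁻¹ • Literature.Geometry.Lorentzian.E4.spatial ((Λ j : Literature.Geometry.Lorentzian.E4 ≃L[ℝ] Literature.Geometry.Lorentzian.E4) (Literature.Geometry.Lorentzian.E4.basisVector 0))) ∧ ∀ ℓ : ℝ, 0 < ℓ → ∀ ε : ℝ, 0 < ε → ∀ τ₁ : ℝ,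 ∃ τ : ℝ, τ₁ ≤ τ ∧ ∃ (ξ : Fin N → Literature.Geometry.Lorentzian.E3) (Φ : Literature.Geometry.Lorentzian.RecedingKerr.layer M a Λ ξ τ ℓ → 𝒟.carrier), (∀ i j, i ≠ j → ε⁻¹ ≤ ‖ξ i - ξ j‖ ∧ 0 ≤ @inner ℝ Literature.Geometry.Lorentzian.E3 _ (ξ i - ξ j) ( (((Λ i : Literature.Geometry.Lorentzian.E4 ≃L[ℝ] Literature.Geometry.Lorentzian.E4) (Literature.Geometry.Lorentzian.E4.basisVector 0)) 0)⁻¹ • Literature.Geometry.Lorentzian.E4.spatial ((Λ i : Literature.Geometry.Lorentzian.E4 ≃L[ℝ] Literature.Geometry.Lorentzian.E4) (Literature.Geometry.Lorentzian.E4.basisVector 0)) - (((Λ j : Literature.Geometry.Lorentzian.E4 ≃L[ℝ] Literature.Geometry.Lorentzian.E4) (Literature.Geometry.Lorentzian.E4.basisVector 0)) 0)⁻¹ • Literature.Geometry.Lorentzian.E4.spatial ((Λ j : Literature.Geometry.Lorentzian.E4 ≃L[ℝ] Literature.Geometry.Lorentzian.E4) (Literature.Geometry.Lorentzian.E4.basisVector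 0)))) ∧ ContMDiff 𝓘(ℝ, Literature.Geometry.Lorentzian.E4) (𝓡 4) ((⊤ : ℕ∞) : WithTop ℕ∞) Φ ∧ Topology.IsOpenEmbedding Φ ∧ Set.range Φ ⊆ 𝒟.metric.causalFuture 𝒟.timeOrientation (Set.range 𝒟.embed) ∧ (∀ s₀ ∈ Set.Ioo 0 ℓ, 𝒟.metric.IsAchronal 𝒟.timeOrientation (Φ '' {x | Literature.Geometry.Lorentzian.RecedingKerr.layerTime τ ℓ x.1 = s₀})) ∧ 𝒟.toSpacetime.recedingKerrInitialLayerNorm M a Λ ξ τ ℓ 2 (1 / 2) (1 / 2) Φ ≤ ENNReal.ofReal ε) → ∃ (O : Set 𝒟.carrier) (d : Literature.Geometry.Lorentzian.FinalStateDecomposition 𝒟.toSpacetime O 2), (∀ i, Literature.Geometry.Lorentzian.Kerr.IsSubextremal (d.mass i) (d.spin i)) ∧ O = Summit.FinalStateConjecture.exteriorOf 𝒟.toCauchyDevelopment d.charted ∧ Summit.FinalStateConjecture.HasExhaustiveCharts d ∧ Summit.FinalStateConjecture.IsFutureOriented d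

-- earlier ThriftyHandoff (stmt-FinalStateConjecture-16094, replaced 2026-08-16T23:23:48Z -> stmt-FinalStateConjecture-17612): retired by None — ∀ (X : Type) [TopologicalSpace X] [ChartedSpace Literature.Geometry.Lorentzian.E3 X] [IsManifold (𝓡 3) ((⊤ : ℕ∞) : WithTop ℕ∞) X] [T2Space X] [SecondCountableTopology X] [ConnectedSpace X], Literature.Geometry.Lorentzian.InitialDataSet.IsChristodoulouGeneric
/-- item stmt-FinalStateConjecture-17612 · crux · rank 4 · open · by planner
why it might fail: WCC + capture + clause C: an open set of data with incomplete 𝓘⁺ or a non-Kerr ω-limit refutes it; parabolic recession or equal velocities may be codim 0; C fails on X = ℝ³#T³ (or #H³/Γ) if an expanding vacuum pocket glued in behind a horizon is curve-stable: complete rays off closure O.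
sources: Christodoulou1999, arXiv:1710.01722, DafermosRodnianski2008, DafermosRodnianski2013, KlainermanSzeftel2023, Bartnik1986
[crux] (the large-data half, ONE TAME-Christodoulou-generic property, tame codimension ≥ 1 in
admissibleVacuumData X: witness families live on one fixed asymptotically flat end, are
weighted-C²-continuous and immersed at the base datum — InitialDataSet.IsTameChristodoulouGeneric …
1, re-type T2, p126844): an MGHD exists, and every MGHD (i) has complete 𝓘⁺, (ii) CAPTURES RAYS —
for every honest typed decomposition (O, d) of it (sub-extremal holes, O = exteriorOf d.charted,
HasExhaustiveCharts d, IsFutureOriented d), every future-complete normalised null ray from Σ stays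
in closure O (RaysStayInClosure; for honest d, closure O is the closure of the future domain of
outer communications whatever d is, so this is the Statement's intrinsic clause C — an
interior-termination statement: null rays from Σ entering a black hole are future-incomplete —
deliberately placed on the large-data side, not in the perturbative endgame), and (iii) admits a
thrifty hand-over — N, sub-extremal labels, orthochronous boosts with pairwise distinct velocities,
and for every ℓ, ε, τ₁ a separating ε-thrifty N-hole layer after τ₁, verbatim the antecedent of
ThriftyClusterSettling. Contains weak cosmic censorsh -/
@[route_item "route-FinalStateConjecture-DerivativeThrift", crux]
def ThriftyHandoff : Prop :=
  ∀ (X : Type) [TopologicalSpace X] [ChartedSpace Literature.Geometry.Lorentzian.E3 X] [IsManifold (𝓡 3) ((⊤ : ℕ∞) : WithTop ℕ∞) X] [T2Space X] [SecondCountableTopology X] [ConnectedSpace X], Literature.Geometry.Lorentzian.InitialDataSet.IsTameChristodoulouGeneric (Literature.Geometry.Lorentzian.admissibleVacuumData X) (fun D ↦ (∃ 𝒟 : Literature.Geometry.Lorentzian.VacuumCauchyDevelopment D, 𝒟.IsMaximal) ∧ ∀ 𝒟 : Literature.Geometry.Lorentzian.VacuumCauchyDevelopment D, 𝒟.IsMaximal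 → Summit.FinalStateConjecture.HasCompleteNullInfinity 𝒟.toCauchyDevelopment ∧ (∀ (O : Set 𝒟.carrier) (d : Literature.Geometry.Lorentzian.FinalStateDecomposition 𝒟.toSpacetime O 2), (∀ i, Literature.Geometry.Lorentzian.Kerr.IsSubextremal (d.mass i) (d.spin i)) → O = Summit.FinalStateConjecture.exteriorOf 𝒟.toCauchyDevelopment d.charted → Summit.FinalStateConjecture.HasExhaustiveCharts d → Summit.FinalStateConjecture.IsFutureOriented d → Summit.FinalStateConjecture.RaysStayInClosure 𝒟.toCauchyDevelopment O) ∧ (∃ (N : ℕ) (M a : Fin N → ℝ) (Λ : Fin N → ↥Literature.Geometry.Lorentzian.lorentzGroup), (∀ i, Literature.Geometry.Lorentzian.Kerr.IsSubextremal (M i) (a i)) ∧ (∀ i, Summit.FinalStateConjecture.IsOrthochronous (Λ i)) ∧ (∀ i j, i ≠ j → (((Λ i : Literature.Geometry.Lorentzian.E4 ≃L[ℝ] Literature.Geometry.Lorentzian.E4) (Literature.Geometry.Lorentzian.E4.basisVector 0)) 0)⁻¹ • Literature.Geometry.Lorentzian.E4.spatial ((Λ i : Literature.Geometry.Lorentzian.E4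 ≃L[ℝ] Literature.Geometry.Lorentzian.E4) (Literature.Geometry.Lorentzian.E4.basisVector 0)) ≠ (((Λ j : Literature.Geometry.Lorentzian.E4 ≃L[ℝ] Literature.Geometry.Lorentzian.E4) (Literature.Geometry.Lorentzian.E4.basisVector 0)) 0)⁻¹ • Literature.Geometry.Lorentzian.E4.spatial ((Λ j : Literature.Geometry.Lorentzian.E4 ≃L[ℝ] Literature.Geometry.Lorentzian.E4) (Literature.Geometry.Lorentzian.E4.basisVector 0))) ∧ ∀ ℓ : ℝ, 0 < ℓ → ∀ ε : ℝ, 0 < ε → ∀ τ₁ : ℝ, ∃ τ : ℝ, τ₁ ≤ τ ∧ ∃ (ξ : Fin N → Literature.Geometry.Lorentzian.E3) (Φ : Literature.Geometry.Lorentzian.RecedingKerr.layer M a Λ ξ τ ℓ → 𝒟.carrier), (∀ i j, i ≠ j → ε⁻¹ ≤ ‖ξ i - ξ j‖ ∧ 0 ≤ @inner ℝ Literature.Geometry.Lorentzian.E3 _ (ξ i - ξ j) ( (((Λ i : Literature.Geometry.Lorentzian.E4 ≃L[ℝ] Literature.Geometry.Lorentzian.E4) (Literature.Geometry.Lorentzian.E4.basisVector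 0)) 0)⁻¹ • Literature.Geometry.Lorentzian.E4.spatial ((Λ i : Literature.Geometry.Lorentzian.E4 ≃L[ℝ] Literature.Geometry.Lorentzian.E4) (Literature.Geometry.Lorentzian.E4.basisVector 0)) - (((Λ j : Literature.Geometry.Lorentzian.E4 ≃L[ℝ] Literature.Geometry.Lorentzian.E4) (Literature.Geometry.Lorentzian.E4.basisVector 0)) 0)⁻¹ • Literature.Geometry.Lorentzian.E4.spatial ((Λ j : Literature.Geometry.Lorentzian.E4 ≃L[ℝ] Literature.Geometry.Lorentzian.E4) (Literature.Geometry.Lorentzian.E4.basisVector 0)))) ∧ ContMDiff 𝓘(ℝ, Literature.Geometry.Lorentzian.E4) (𝓡 4) ((⊤ : ℕ∞) : WithTop ℕ∞) Φ ∧ Topology.IsOpenEmbedding Φ ∧ Set.range Φ ⊆ 𝒟.metric.causalFuture 𝒟.timeOrientation (Set.range 𝒟.embed) ∧ (∀ s₀ ∈ Set.Ioo 0 ℓ, 𝒟.metric.IsAchronal 𝒟.timeOrientation (Φ '' {x | Literature.Geometry.Lorentzian.RecedingKerr.layerTime τ ℓ x.1 = s₀})) ∧ 𝒟.toSpacetime.recedingKerrInitialLayerNorm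 M a Λ ξ τ ℓ 2 (1 / 2) (1 / 2) Φ ≤ ENNReal.ofReal ε)) 1

-- earlier ThriftyMinkowskiStability (stmt-FinalStateConjecture-16095, replaced 2026-08-16T23:23:48Z -> stmt-FinalStateConjecture-17613): retired by None — ∀ ℓ : ℝ, 0 < ℓ → ∃ ε : ℝ, 0 < ε ∧ ∀ (X : Type) [TopologicalSpace X] [ChartedSpace Literature.Geometry.Lorentzian.E3 X] [IsManifold (𝓡 3) ((⊤ : ℕ∞) : WithTop ℕ∞) X] [T2Space X] [SecondCountableTopology X] [ConnectedSpace X] (D : Literature.Geometry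
/-- item stmt-FinalStateConjecture-17613 · support · rank 9 · open · by planner
sources: Bieri2010JDG, ChristodoulouKlainerman1993, LindbladRodnianski2010Annals, Moschidis2016
[support] the N = 0 analogue of ThriftyKerrStability (conclusion re-typed rev 1, same route-review
R2 defect): for every ℓ > 0 there is ε > 0 such that every smooth open embedding Φ of the
empty-configuration (Minkowski) hyperboloidal layer into an MGHD of admissible data, image in
J⁺(ιX), achronal leaves, 𝔑_(2,1/2,1/2) ≤ ε, is followed by a FLAT NEAR ZONE: a late chart Ψ of
Minkowski space into J⁺(range Φ) (Spacetime.IsLateChart: smooth, an open embedding of {x⁰ > τ′}) and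
radii R(σ) → ∞ with the C² deviation of Ψ^*g from η on the balls {x⁰ = σ, |x̲| ≤ R(σ)} tending to 0
as σ → ∞ and ∂₀ eventually pushed forward future-directed there (Bieri's curvature+1-derivative
theorem in hyperboloidal layer form, interior decay; the N = 0 leg of ThriftyClusterSettling; flat
slabs out to i⁰ are not claimed — they never lie in J⁺ of a hyperboloidal layer). [difficulty: XL] -/
@[route_item "route-FinalStateConjecture-DerivativeThrift"]
def ThriftyMinkowskiStability : Prop :=
  ∀ ℓ : ℝ, 0 < ℓ → ∃ ε : ℝ, 0 < ε ∧ ∀ (X : Type) [TopologicalSpace X] [ChartedSpace Literature.Geometry.Lorentzian.E3 X] [IsManifold (𝓡 3) ((⊤ : ℕ∞) : WithTop ℕ∞) X] [T2Space X] [SecondCountableTopology X] [ConnectedSpace X] (D : Literature.Geometry.Lorentzian.InitialDataSet (𝓡 3) X), D ∈ Literature.Geometry.Lorentzian.admissibleVacuumData X → ∀ 𝒟 : Literature.Geometry.Lorentzian.VacuumCauchyDevelopment D, 𝒟.IsMaximal → ∀ (τ : ℝ) (Φ : Literature.Geometry.Lorentzian.RecedingKerr.layer (![] : Fin 0 → ℝ)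 (![] : Fin 0 → ℝ) (![] : Fin 0 → ↥Literature.Geometry.Lorentzian.lorentzGroup) (![] : Fin 0 → Literature.Geometry.Lorentzian.E3) τ ℓ → 𝒟.carrier), ContMDiff 𝓘(ℝ, Literature.Geometry.Lorentzian.E4) (𝓡 4) ((⊤ : ℕ∞) : WithTop ℕ∞) Φ → Topology.IsOpenEmbedding Φ → Set.range Φ ⊆ 𝒟.metric.causalFuture 𝒟.timeOrientation (Set.range 𝒟.embed) → (∀ s₀ ∈ Set.Ioo 0 ℓ, 𝒟.metric.IsAchronal 𝒟.timeOrientation (Φ '' {x | Literature.Geometry.Lorentzian.RecedingKerr.layerTime τ ℓ x.1 = s₀})) → 𝒟.toSpacetime.recedingKerrInitialLayerNorm (![] : Fin 0 → ℝ) (![] : Fin 0 → ℝ) (![] : Fin 0 → ↥Literature.Geometry.Lorentzian.lorentzGroup) (![] : Fin 0 → Literature.Geometry.Lorentzian.E3) τ ℓ 2 (1 / 2) (1 / 2) Φ ≤ ENNReal.ofReal ε → ∃ (τ' : ℝ) (Ψ : Literature.Geometry.Lorentzian.Minkowski.background.domain → 𝒟.carrier) (R : ℝ → ℝ), 𝒟.toSpacetime.IsLateChart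 Literature.Geometry.Lorentzian.Minkowski.background (𝒟.metric.causalFuture 𝒟.timeOrientation (Set.range Φ)) τ' Ψ ∧ Filter.Tendsto R Filter.atTop Filter.atTop ∧ Filter.Tendsto (fun σ ↦ 𝒟.toSpacetime.truncDeviationCk Literature.Geometry.Lorentzian.Minkowski.background Ψ 2 (R σ) σ) Filter.atTop (nhds 0) ∧ ∀ ρ : ℝ, ∀ᶠ σ in Filter.atTop, ∀ x ∈ Literature.Geometry.Lorentzian.Minkowski.background.truncTimeSlab ρ σ, 𝒟.timeOrientation.IsFutureDirected (mfderiv 𝓘(ℝ, Literature.Geometry.Lorentzian.E4) (𝓡 4) Ψ x (Literature.Geometry.Lorentzian.E4.basisVector 0))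

/-- item stmt-FinalStateConjecture-16096 · assembly · rank 1 · open · by planner
sources: Christodoulou1999, arXiv:1710.01722
[assembly] ThriftyKerrStability → ThriftyClusterSettling → ThriftyHandoff → the Statement (proved as
`closes` in glue.lean). -/
@[route_item "route-FinalStateConjecture-DerivativeThrift"]
def Assembly : Prop :=
  ThriftyKerrStability → ThriftyClusterSettling → ThriftyHandoff → FinalStateConjecture

/-! D-0027 §2.1 — DECIDING THEOREM (planner-authored via `route open/edit --closes-file`; by planner-rbadge-FinalStateConjecture-Derivative-a39e9bf2-0 2026-08-16T23:39:56Z):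
its hypotheses are this route's items and its conclusion the sub-problem Statement (glue_lint), and it elaborates with this file. -/

@[closes "route-FinalStateConjecture-DerivativeThrift"] theorem closes (h1 : ThriftyKerrStability) (h2 : ThriftyClusterSettling) (h3 : ThriftyHandoff) :
    FinalStateConjecture := by
  intro X _ _ _ _ _ _
  -- tame Christodoulou codimension is antitone in the exceptional set: a pointwise implication
  -- `Q → P` on admissible data transports tame genericity of `Q` to tame genericity of `P`
  have mono : ∀ {𝓓 : Set (Literature.Geometry.Lorentzian.InitialDataSet (𝓡 3) X)}
      {Q P : Literature.Geometry.Lorentzian.InitialDataSet (𝓡 3) X → Prop},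
      (∀ D ∈ 𝓓, Q D → P D) →
        Literature.Geometry.Lorentzian.InitialDataSet.IsTameChristodoulouGeneric 𝓓 Q 1 →
          Literature.Geometry.Lorentzian.InitialDataSet.IsTameChristodoulouGeneric 𝓓 P 1 := by
    intro 𝓓 Q P hQP hQ D hD
    obtain ⟨e, F, hF, himm, h0, hinj, hadm, hgood⟩ := hQ D ⟨hD.1, fun h ↦ hD.2 (hQP D hD.1 h)⟩
    exact ⟨e, F, hF, himm, h0, hinj, hadm,
      fun c hc hmem ↦ hgood c hc ⟨hmem.1, fun h ↦ hmem.2 (hQP _ hmem.1 h)⟩⟩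
  refine mono ?_ (h3 X)
  intro D hD hQ
  dsimp only at hQ ⊢
  refine ⟨hQ.1, fun 𝒟 h𝒟 ↦ ⟨(hQ.2 𝒟 h𝒟).1, ?_⟩⟩
  -- the endgame turns the thrifty hand-over into an honest, future-oriented, exhaustive
  -- sub-extremal decomposition; the hand-over's ray-capture clause supplies `RaysStayInClosure`
  obtain ⟨O, d, hsub, hO, hex, hfo⟩ := h2 h1 X D hD 𝒟 h𝒟 (hQ.2 𝒟 h𝒟).1 (hQ.2 𝒟 h𝒟).2.2
  exact ⟨O, d, hsub, hO, (hQ.2 𝒟 h𝒟).2.1 O d hsub hO hex hfo, hex, hfo⟩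

end Summit.FinalStateConjecture.FinalStateConjecture.Theses.DerivativeThrift
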